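import Mathlib
import Summits.Ventures.PercRepro.TriangleCapSubBandInterval
import Summits.Ventures.PercRepro.TriangleCapSubBandStructure

/-!
# PercRepro — THE BAND ON `n` VERTICES, EXACTLY, DOWN TO ANY DEPTH: THE UNION OF THE SUB-BAND INTERVALS (p3, gen 52;
part 264)

On `ℓ + 1 + (s − t)` vertices (`2 ≤ ℓ`, `4 u₀ + 3 ≤ t`, `ℓ + u₀ + 1 ≤ t`, `2 t ≤ s`) a band value `2 j` below
`(u₀ + 1)(t − u₀ − 2)` is attained IFF `j` lies in one of the sub-band intervals `u ≤ u₀`: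
`u (t − u − 1) ≤ j` and `2 j + 2 q u ≤ 2 u (t − u − 1) + u (u + 1) + (ℓ − 1) q (q + 1)` at `q = max 1 ⌊u / (ℓ − 1)⌋`
(`band_exact`) — the structure theorem of part 260 one way, the star witness (`u = 0`, part 254) and the interval
theorems of part 263 the other.  So the band on `n` vertices is, down to any depth, the union of the intervals
`[u (t − u − 1), u (t − u − 1) + W(u, ℓ)]`, `W(u, ℓ) = C(u, 2) + ℓ − 1` for `u ≤ ℓ − 1` and the balanced round-robin
value beyond.  Axioms: standard.
-/

namespace PercRepro

namespace TriangleCap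

namespace C047

open Finset

/-- The tangent parameter of the sub-band `u`: `max 1 ⌊u / (ℓ − 1)⌋`. -/
def subQ (ℓ u : ℕ) : ℕ := max 1 (u / (ℓ - 1))

/-- **THE BAND ON `n` VERTICES BELOW `(u₀ + 1)(t − u₀ − 2)`, EXACTLY:** for `2 ≤ ℓ`, `4 u₀ + 3 ≤ t`, `ℓ + u₀ + 1 ≤ t`,
`2 t ≤ s` and `j < (u₀ + 1)(t − u₀ − 2)`, the band value `2 j` is attained on `ℓ + 1 + (s − t)` vertices iff for some
`u ≤ u₀`: `u (t − u − 1) ≤ j` and `2 j + 2 q u ≤ 2 u (t − u − 1) + u (u + 1) + (ℓ − 1) q (q + 1)`, `q = subQ ℓ u`. -/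
theorem band_exact (ℓ s t u₀ j : ℕ) (hℓ : 2 ≤ ℓ) (ht0 : 4 * u₀ + 3 ≤ t) (hℓt : ℓ + u₀ + 1 ≤ t) (hs : 2 * t ≤ s)
    (hj : j < (u₀ + 1) * (t - u₀ - 2)) :
    (∃ (H : SimpleGraph (Fin (ℓ + 1 + (s - t)))) (_ : DecidableRel H.Adj), H.CliqueFree 3 ∧
      H.edgeFinset.card = s ∧ (∃ w, deg H w + t = s) ∧
      ∑ v, deg H v * deg H v + 2 * (t * (s - t - 1)) + 2 * j = s * (s + 1)) ↔
    ∃ u, u ≤ u₀ ∧ u * (t - u - 1) ≤ j ∧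
      2 * j + 2 * (subQ ℓ u * u) ≤ 2 * (u * (t - u - 1)) + u * (u + 1) + (ℓ - 1) * (subQ ℓ u * (subQ ℓ u + 1)) := by
  constructor
  · rintro ⟨H, _, hfree, hs', ⟨w, hw⟩, hj'⟩
    rcases subband_structure_vertices ℓ s t H hfree hs' w hw (by omega) u₀ j ht0 hℓt hj' with
      ⟨u, hu, hlow, hup⟩ | hbig
    · exact ⟨u, hu, hlow, hup (subQ ℓ u) (le_max_left _ _)⟩
    · omega
  · rintro ⟨u, hu, hlow, hup⟩
    rcases Nat.eq_zero_or_pos u with rfl | hu1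
    · -- the star sub-band
      unfold subQ at hup
      rw [Nat.zero_div, max_eq_left (Nat.zero_le 1)] at hup
      simp only [mul_zero, zero_mul, add_zero, zero_add] at hup
      exact starWitness ℓ s t j (by omega) hs (by omega) (by omega)
    · rcases Nat.lt_or_ge u (ℓ - 1) with hsmall | hbig
      · -- `u ≤ ℓ − 2`: the tangent bound at `q = 1`
        have hq : subQ ℓ u = 1 := by
          unfold subQ
          rw [Nat.div_eq_of_lt hsmall, max_eq_left (Nat.zero_le 1)]
        rw [hq] at hup
        apply subband_interval_small ℓ s t u j hu1 (by omega) (by omega) (by omega) hs hlow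
        omega
      · -- `u ≥ ℓ − 1`: the tangent bound at `q = ⌊u / (ℓ − 1)⌋ ≥ 1`
        have hq : subQ ℓ u = u / (ℓ - 1) := by
          unfold subQ
          exact max_eq_right (Nat.div_pos hbig (by omega))
        rw [hq] at hup
        exact (subband_interval_exact ℓ s t u hℓ (by omega) (by omega) hs).2 j hlow hup

/-- **THE GAPS:** under the hypotheses of `band_exact`, a value `j` above the tops of the sub-bands `u′ ≤ u` and below
the bottom `(u + 1)(t − u − 2)` of the sub-band `u + 1` (`u + 1 ≤ u₀`) is not attained. -/
theorem band_gap (ℓ s t u₀ u j : ℕ) (hℓ : 2 ≤ ℓ) (ht0 : 4 * u₀ + 3 ≤ t) (hℓt : ℓ + u₀ + 1 ≤ t) (hs : 2 * t ≤ s)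
    (hu : u + 1 ≤ u₀)
    (htop : ∀ u', u' ≤ u → 2 * (u' * (t - u' - 1)) + u' * (u' + 1) + (ℓ - 1) * (subQ ℓ u' * (subQ ℓ u' + 1)) <
      2 * j + 2 * (subQ ℓ u' * u'))
    (hbot : j < (u + 1) * (t - u - 2)) :
    ¬ ∃ (H : SimpleGraph (Fin (ℓ + 1 + (s - t)))) (_ : DecidableRel H.Adj), H.CliqueFree 3 ∧
      H.edgeFinset.card = s ∧ (∃ w, deg H w + t = s) ∧
      ∑ v, deg H v * deg H v + 2 * (t * (s - t - 1)) + 2 * j = s * (s + 1) := by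
  intro h
  have hj : j < (u₀ + 1) * (t - u₀ - 2) := by
    have := subband_bottom_concave t (u₀ + 1) u (by omega) (by omega)
    have e : t - (u₀ + 1) - 1 = t - u₀ - 2 := by omega
    rw [e] at this
    omega
  obtain ⟨u', hu', hlow, hup⟩ := (band_exact ℓ s t u₀ j hℓ ht0 hℓt hs hj).mp h
  rcases Nat.lt_or_ge u u' with hlt | hle
  · have := subband_bottom_concave t u' u (by omega) (by omega)
    omega
  · have := htop u' hle
    omega

end C047

end TriangleCap

end PercRepro
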